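import Mathlib
import HarnessLib
import Literature.MathematicalPhysics.QuantumLattice.GrassmannLinearSubstitution
import Summits.HubbardSuperconductivity.HubbardSuperconductivity.Theorems.KLProgrammeKLRegimeWickStarProduct

/-!
# Route `KLProgramme` — ENGINE child, `stub_engine_step_values` (E2), E2-WICK-ROADMAP §5 (iv):
# the two-copy carriers under a LINEAR FIELD SUBSTITUTION (physical fields ↔ sector fields)

Cell gate-hubbard-kl, seat p5 (g4).  The `k + 1`-line two-vertex bounds of …WickCrossContraction{Sum,Sector,Sized,Value} are stated for vertices on
SECTOR fields (`sectorPreimage β F G`) with pulled-back lines `Sᵀ·C·S`; the (E2) expansion (p1 g9, k3c1) runs on the PHYSICAL carriers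
`klWickAction … n` with the doubling maps `dblCopy`, `dblFold`, `crossCov`.  A linear substitution `ψ ↦ M ψ` of the fields
(`ExteriorAlgebra.map (toLin' M)`, `GrassmannLinearSubstitution`) doubles to `M ⊗ₖ 1₂` on `Γ × Fin 2` and commutes with all three:

* `dblEmbMat_mul`, `dblProjMat_mul_kronecker` — the matrix identities `E_s·M = (M ⊗ₖ 1)·E_s`, `P·(M ⊗ₖ 1) = M·P`;
* **`map_kronecker_dblCopy`**: `map (M ⊗ₖ 1) (dblCopy s x) = dblCopy s (map M x)`; **`dblFold_map_kronecker`**: `dblFold (map (M ⊗ₖ 1) y) = map M (dblFold y)`;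
* `kronecker_transpose_mul_dblCov_mul`, **`kronecker_transpose_mul_crossCov_mul`**: `(M ⊗ₖ 1)ᵀ·crossCov C·(M ⊗ₖ 1) = crossCov (Mᵀ·C·M)`;
* **`grassmannLaplacian_crossCov_map`**: `Δ_×(C) (map (M ⊗ₖ 1) y) = map (M ⊗ₖ 1) (Δ_×(Mᵀ·C·M) y)` (`grassmannLaplacian_map`);
  `listProd_crossLaplacian_map` — the same for `Δ_×(C_k)∘⋯∘Δ_×(C_0)`;
* **`dblFold_crossContract_map`** — THE TRANSPORT: for `a = map M a′`, `b = map M b′`,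
  `dblFold ((Δ_×(C_k)∘⋯∘Δ_×(C_0))(a⁰·b¹)) = map M (dblFold ((Δ_×(MᵀC_kM)∘⋯∘Δ_×(MᵀC_0M))(a′⁰·b′¹)))`:
  the physical `k + 1`-line term between `Ga = map S a′` and `Gb = map S b′` (`S = sectorSubMatrix β F̃`, `a′ = sectorPreimage β F Ga` by
  `map_sectorSub_sectorPreimage`) IS the push-forward of the sector-field term with the pulled-back lines — the object the landed bounds size.

Pure algebra over a commutative ring; no definitions (the doubled matrix is Mathlib's Kronecker product `M ⊗ₖ (1 : Matrix (Fin 2) (Fin 2) R)`),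
no named facts, nothing about the model.
-/

noncomputable section

namespace Summit.HubbardSuperconductivity.HubbardSuperconductivity.Theorems.KLRegimeWick

set_option linter.dupNamespace false -- summit = problem name (single-conjunct summit), D-0017

open Literature.MathematicalPhysics.QuantumLattice GrassmannAlgebra Finset Matrix
open scoped Kronecker

section Substitution

variable (R : Type*) [CommRing R] {Γ Γ' : Type*} [Fintype Γ] [DecidableEq Γ] [Fintype Γ'] [DecidableEq Γ']

omit [Fintype Γ] [DecidableEq Γ] [Fintype Γ'] [DecidableEq Γ'] in
/-- Entries of the doubled substitution matrix: `(M ⊗ₖ 1) p q = [p.2 = q.2]·M p.1 q.1`. -/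
theorem kronecker_one_apply (M : Matrix Γ' Γ R) (p : Γ' × Fin 2) (q : Γ × Fin 2) :
    (M ⊗ₖ (1 : Matrix (Fin 2) (Fin 2) R)) p q = if p.2 = q.2 then M p.1 q.1 else 0 := by
  rw [Matrix.kroneckerMap_apply, Matrix.one_apply, mul_ite, mul_one, mul_zero]

omit [Fintype Γ] [DecidableEq Γ] [Fintype Γ'] in
/-- Entries of the copy matrix. -/
theorem dblEmbMat_apply' (s : Fin 2) (p : Γ' × Fin 2) (X : Γ') : dblEmbMat R (Γ := Γ') s p X = if p = (X, s) then 1 else 0 := rfl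

omit [Fintype Γ] [DecidableEq Γ] [Fintype Γ'] in
/-- Entries of the fold matrix. -/
theorem dblProjMat_apply' (X : Γ') (q : Γ' × Fin 2) : dblProjMat R (Γ := Γ') X q = if X = q.1 then 1 else 0 := rfl

/-- `E_s · M = (M ⊗ₖ 1) · E_s`: copying after substituting is substituting (doubled) after copying. -/
theorem dblEmbMat_mul (M : Matrix Γ' Γ R) (s : Fin 2) :
    dblEmbMat R (Γ := Γ') s * M = (M ⊗ₖ (1 : Matrix (Fin 2) (Fin 2) R)) * dblEmbMat R (Γ := Γ) s := by
  ext p Y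
  rw [Matrix.mul_apply, Matrix.mul_apply,
    Finset.sum_eq_single p.1 (fun X _ hX => by rw [dblEmbMat_apply', if_neg (fun h => hX (by rw [h])), zero_mul])
      (fun h => absurd (mem_univ _) h),
    Finset.sum_eq_single (Y, s) (fun q _ hq => by rw [dblEmbMat_apply', if_neg hq, mul_zero]) (fun h => absurd (mem_univ _) h),
    dblEmbMat_apply', dblEmbMat_apply', kronecker_one_apply, if_pos rfl, mul_one]
  obtain ⟨X', t⟩ := p
  by_cases h : t = s
  · subst h
    rw [if_pos rfl, if_pos rfl, one_mul]
  · rw [if_neg (fun h' => h (Prod.mk.inj h').2), if_neg h, zero_mul]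

/-- `E_sᵀ · (M ⊗ₖ 1) = M · E_sᵀ` (the transposed copy matrix). -/
theorem dblEmbMat_transpose_mul_kronecker (M : Matrix Γ' Γ R) (s : Fin 2) :
    (dblEmbMat R (Γ := Γ') s).transpose * (M ⊗ₖ (1 : Matrix (Fin 2) (Fin 2) R)) = M * (dblEmbMat R (Γ := Γ) s).transpose := by
  ext X' q
  rw [Matrix.mul_apply, Matrix.mul_apply,
    Finset.sum_eq_single (X', s) (fun p _ hp => by rw [Matrix.transpose_apply, dblEmbMat_apply', if_neg hp, zero_mul])
      (fun h => absurd (mem_univ _) h),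
    Finset.sum_eq_single q.1 (fun X _ hX => by
        rw [Matrix.transpose_apply, dblEmbMat_apply', if_neg (fun h => hX (by rw [h])), mul_zero])
      (fun h => absurd (mem_univ _) h),
    Matrix.transpose_apply, Matrix.transpose_apply, dblEmbMat_apply', dblEmbMat_apply', kronecker_one_apply, if_pos rfl, one_mul]
  obtain ⟨Y, t⟩ := q
  by_cases h : t = s
  · subst h
    rw [if_pos rfl, if_pos rfl, mul_one]
  · rw [if_neg (fun h' => h h'.symm), if_neg (fun h' => h (Prod.mk.inj h').2), mul_zero]

/-- `P · (M ⊗ₖ 1) = M · P`: folding after the doubled substitution is substituting after folding. -/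
theorem dblProjMat_mul_kronecker (M : Matrix Γ' Γ R) :
    dblProjMat R (Γ := Γ') * (M ⊗ₖ (1 : Matrix (Fin 2) (Fin 2) R)) = M * dblProjMat R (Γ := Γ) := by
  ext X' q
  rw [Matrix.mul_apply, Matrix.mul_apply,
    Finset.sum_eq_single (X', q.2) (fun p _ hp => by
        rw [dblProjMat_apply', kronecker_one_apply]
        by_cases h1 : X' = p.1
        · rw [if_pos h1, one_mul, if_neg (fun h2 => hp (Prod.ext h1.symm h2))]
        · rw [if_neg h1, zero_mul])
      (fun h => absurd (mem_univ _) h),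
    Finset.sum_eq_single q.1 (fun X _ hX => by rw [dblProjMat_apply', if_neg hX, mul_zero])
      (fun h => absurd (mem_univ _) h)]
  simp only [dblProjMat_apply', kronecker_one_apply, if_true, one_mul, mul_one]

/-- **Copy commutes with substitution**: `map (M ⊗ₖ 1) (dblCopy s x) = dblCopy s (map M x)`. -/
theorem map_kronecker_dblCopy (M : Matrix Γ' Γ R) (s : Fin 2) (x : GrassmannAlgebra R Γ) :
    ExteriorAlgebra.map (Matrix.toLin' (M ⊗ₖ (1 : Matrix (Fin 2) (Fin 2) R))) (dblCopy R s x) =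
      dblCopy R s (ExteriorAlgebra.map (Matrix.toLin' M) x) := by
  have h : (ExteriorAlgebra.map (Matrix.toLin' (M ⊗ₖ (1 : Matrix (Fin 2) (Fin 2) R)))).comp (dblCopy R (Γ := Γ) s) =
      (dblCopy R (Γ := Γ') s).comp (ExteriorAlgebra.map (Matrix.toLin' M)) := by
    rw [dblCopy, dblCopy, ExteriorAlgebra.map_comp_map, ExteriorAlgebra.map_comp_map, ← Matrix.toLin'_mul, ← Matrix.toLin'_mul,
      dblEmbMat_mul]
  exact congrArg (fun φ : GrassmannAlgebra R Γ →ₐ[R] GrassmannAlgebra R (Γ' × Fin 2) => φ x) h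

/-- **Fold commutes with substitution**: `dblFold (map (M ⊗ₖ 1) y) = map M (dblFold y)`. -/
theorem dblFold_map_kronecker (M : Matrix Γ' Γ R) (y : GrassmannAlgebra R (Γ × Fin 2)) :
    dblFold R (ExteriorAlgebra.map (Matrix.toLin' (M ⊗ₖ (1 : Matrix (Fin 2) (Fin 2) R))) y) =
      ExteriorAlgebra.map (Matrix.toLin' M) (dblFold R y) := by
  have h : (dblFold R (Γ := Γ')).comp (ExteriorAlgebra.map (Matrix.toLin' (M ⊗ₖ (1 : Matrix (Fin 2) (Fin 2) R)))) =
      (ExteriorAlgebra.map (Matrix.toLin' M)).comp (dblFold R (Γ := Γ)) := by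
    rw [dblFold, dblFold, ExteriorAlgebra.map_comp_map, ExteriorAlgebra.map_comp_map, ← Matrix.toLin'_mul, ← Matrix.toLin'_mul,
      dblProjMat_mul_kronecker]
  exact congrArg (fun φ : GrassmannAlgebra R (Γ × Fin 2) →ₐ[R] GrassmannAlgebra R Γ' => φ y) h

/-- The blocks factor through the copy matrices: `dblCov C s t = E_s · C · E_tᵀ`. -/
theorem dblCov_eq_dblEmbMat_mul (C : Matrix Γ' Γ' R) (s t : Fin 2) :
    dblCov R C s t = dblEmbMat R (Γ := Γ') s * C * (dblEmbMat R (Γ := Γ') t).transpose := by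
  ext p q
  rw [dblCov_apply, Matrix.mul_apply,
    Finset.sum_eq_single q.1 (fun Y _ hY => by
        rw [Matrix.transpose_apply, dblEmbMat_apply', if_neg (fun h => hY (by rw [h])), mul_zero])
      (fun h => absurd (mem_univ _) h),
    Matrix.mul_apply,
    Finset.sum_eq_single p.1 (fun X _ hX => by rw [dblEmbMat_apply', if_neg (fun h => hX (by rw [h])), zero_mul])
      (fun h => absurd (mem_univ _) h),
    Matrix.transpose_apply, dblEmbMat_apply', dblEmbMat_apply']
  obtain ⟨X, s'⟩ := p
  obtain ⟨Y, t'⟩ := q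
  by_cases hs : s' = s
  · by_cases ht : t' = t
    · subst hs; subst ht
      rw [if_pos ⟨rfl, rfl⟩, if_pos rfl, if_pos rfl, one_mul, mul_one]
    · rw [if_neg (fun h => ht h.2), if_neg (fun h' => ht (Prod.mk.inj h').2), mul_zero]
  · rw [if_neg (fun h => hs h.1), if_neg (fun h' => hs (Prod.mk.inj h').2), zero_mul, zero_mul]

/-- The blocks pull back: `(M ⊗ₖ 1)ᵀ · dblCov C s t · (M ⊗ₖ 1) = dblCov (Mᵀ·C·M) s t`. -/
theorem kronecker_transpose_mul_dblCov_mul (M : Matrix Γ' Γ R) (C : Matrix Γ' Γ' R) (s t : Fin 2) :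
    (M ⊗ₖ (1 : Matrix (Fin 2) (Fin 2) R)).transpose * dblCov R C s t * (M ⊗ₖ (1 : Matrix (Fin 2) (Fin 2) R)) =
      dblCov R (M.transpose * C * M) s t := by
  have hs : (M ⊗ₖ (1 : Matrix (Fin 2) (Fin 2) R)).transpose * dblEmbMat R (Γ := Γ') s = dblEmbMat R (Γ := Γ) s * M.transpose := by
    rw [← Matrix.transpose_transpose (dblEmbMat R (Γ := Γ') s), ← Matrix.transpose_mul, dblEmbMat_transpose_mul_kronecker,
      Matrix.transpose_mul, Matrix.transpose_transpose]
  have ht : (dblEmbMat R (Γ := Γ') t).transpose * (M ⊗ₖ (1 : Matrix (Fin 2) (Fin 2) R)) = M * (dblEmbMat R (Γ := Γ) t).transpose :=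
    dblEmbMat_transpose_mul_kronecker R M t
  have hassoc : (M ⊗ₖ (1 : Matrix (Fin 2) (Fin 2) R)).transpose *
      (dblEmbMat R (Γ := Γ') s * C * (dblEmbMat R (Γ := Γ') t).transpose) * (M ⊗ₖ (1 : Matrix (Fin 2) (Fin 2) R)) =
      ((M ⊗ₖ (1 : Matrix (Fin 2) (Fin 2) R)).transpose * dblEmbMat R (Γ := Γ') s) * C *
        ((dblEmbMat R (Γ := Γ') t).transpose * (M ⊗ₖ (1 : Matrix (Fin 2) (Fin 2) R))) := by
    simp only [Matrix.mul_assoc]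
  rw [dblCov_eq_dblEmbMat_mul, dblCov_eq_dblEmbMat_mul, hassoc, hs, ht]
  simp only [Matrix.mul_assoc]

/-- **The cross covariance pulls back**: `(M ⊗ₖ 1)ᵀ · crossCov C · (M ⊗ₖ 1) = crossCov (Mᵀ·C·M)`. -/
theorem kronecker_transpose_mul_crossCov_mul (M : Matrix Γ' Γ R) (C : Matrix Γ' Γ' R) :
    (M ⊗ₖ (1 : Matrix (Fin 2) (Fin 2) R)).transpose * crossCov R C * (M ⊗ₖ (1 : Matrix (Fin 2) (Fin 2) R)) =
      crossCov R (M.transpose * C * M) := by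
  rw [crossCov, crossCov, Matrix.mul_add, Matrix.add_mul, kronecker_transpose_mul_dblCov_mul, kronecker_transpose_mul_dblCov_mul]

variable [Algebra ℚ R]

/-- **The cross Laplacian is covariant**: `Δ_×(C) (map (M ⊗ₖ 1) y) = map (M ⊗ₖ 1) (Δ_×(Mᵀ·C·M) y)`. -/
theorem grassmannLaplacian_crossCov_map (M : Matrix Γ' Γ R) (C : Matrix Γ' Γ' R) (y : GrassmannAlgebra R (Γ × Fin 2)) :
    grassmannLaplacian R (crossCov R C) (ExteriorAlgebra.map (Matrix.toLin' (M ⊗ₖ (1 : Matrix (Fin 2) (Fin 2) R))) y) =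
      ExteriorAlgebra.map (Matrix.toLin' (M ⊗ₖ (1 : Matrix (Fin 2) (Fin 2) R))) (grassmannLaplacian R (crossCov R (M.transpose * C * M)) y) := by
  rw [grassmannLaplacian_map, LinearMap.toMatrix'_toLin', kronecker_transpose_mul_crossCov_mul]

/-- The iterated cross Laplacians are covariant: `(Δ_×(C_k)∘⋯∘Δ_×(C_0)) ∘ map (M ⊗ₖ 1) = map (M ⊗ₖ 1) ∘ (Δ_×(MᵀC_kM)∘⋯∘Δ_×(MᵀC_0M))`. -/
theorem listProd_crossLaplacian_map {k : ℕ} (M : Matrix Γ' Γ R) (C : Fin k → Matrix Γ' Γ' R) (y : GrassmannAlgebra R (Γ × Fin 2)) :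
    ((List.ofFn fun i => grassmannLaplacian R (crossCov R (C i))).reverse).prod
        (ExteriorAlgebra.map (Matrix.toLin' (M ⊗ₖ (1 : Matrix (Fin 2) (Fin 2) R))) y) =
      ExteriorAlgebra.map (Matrix.toLin' (M ⊗ₖ (1 : Matrix (Fin 2) (Fin 2) R)))
        (((List.ofFn fun i => grassmannLaplacian R (crossCov R (M.transpose * C i * M))).reverse).prod y) := by
  induction k with
  | zero => simp
  | succ k ih =>
    rw [List.ofFn_succ', List.ofFn_succ', List.concat_eq_append, List.concat_eq_append, List.reverse_append, List.reverse_append,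
      List.reverse_singleton, List.reverse_singleton, List.singleton_append, List.singleton_append, List.prod_cons, List.prod_cons,
      Module.End.mul_apply, Module.End.mul_apply, ih (fun i => C i.castSucc), grassmannLaplacian_crossCov_map]

/-- **The transport of the `k + 1`-line two-vertex term**: for vertices obtained by substitution, `a = map M a′`, `b = map M b′`,
`dblFold ((Δ_×(C_k)∘⋯∘Δ_×(C_0))(a⁰·b¹)) = map M (dblFold ((Δ_×(MᵀC_kM)∘⋯∘Δ_×(MᵀC_0M))(a′⁰·b′¹)))`. -/
theorem dblFold_crossContract_map {k : ℕ} (M : Matrix Γ' Γ R) (C : Fin k → Matrix Γ' Γ' R) (a' b' : GrassmannAlgebra R Γ) :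
    dblFold R (((List.ofFn fun i => grassmannLaplacian R (crossCov R (C i))).reverse).prod
        (dblCopy R 0 (ExteriorAlgebra.map (Matrix.toLin' M) a') * dblCopy R 1 (ExteriorAlgebra.map (Matrix.toLin' M) b'))) =
      ExteriorAlgebra.map (Matrix.toLin' M) (dblFold R (((List.ofFn fun i =>
        grassmannLaplacian R (crossCov R (M.transpose * C i * M))).reverse).prod (dblCopy R 0 a' * dblCopy R 1 b'))) := by
  rw [← map_kronecker_dblCopy, ← map_kronecker_dblCopy, ← map_mul, listProd_crossLaplacian_map, dblFold_map_kronecker]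

/-- The same for one covariance iterated: `dblFold ((Δ_×(C))^n (a⁰·b¹)) = map M (dblFold ((Δ_×(MᵀCM))^n (a′⁰·b′¹)))`. -/
theorem dblFold_crossLaplacian_pow_map (n : ℕ) (M : Matrix Γ' Γ R) (C : Matrix Γ' Γ' R) (a' b' : GrassmannAlgebra R Γ) :
    dblFold R (((grassmannLaplacian R (crossCov R C)) ^ n)
        (dblCopy R 0 (ExteriorAlgebra.map (Matrix.toLin' M) a') * dblCopy R 1 (ExteriorAlgebra.map (Matrix.toLin' M) b'))) =
      ExteriorAlgebra.map (Matrix.toLin' M) (dblFold R (((grassmannLaplacian R (crossCov R (M.transpose * C * M))) ^ n)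
        (dblCopy R 0 a' * dblCopy R 1 b'))) := by
  have h := dblFold_crossContract_map R M (fun _ : Fin n => C) a' b'
  rwa [List.ofFn_const, List.ofFn_const, List.reverse_replicate, List.reverse_replicate, List.prod_replicate, List.prod_replicate] at h

end Substitution

end Summit.HubbardSuperconductivity.HubbardSuperconductivity.Theorems.KLRegimeWick
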